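import Literature.NumberTheory.Automorphic.HeckeFixedVectorsIntertwinersLevelwise
import HarnessLib

/-!
# Semilinear form of the LEVELWISE extension theorem (`ι`-semilinear Hecke-equivariant maps on `K`-fixed vectors extend to
# `ι`-semilinear intertwiners, from levelwise semisimplicity of the target)

Topic `NumberTheory/Automorphic`; namespace `Literature.NumberTheory.Automorphic`.  THEOREMS ONLY (no definition, no named fact, no
instance, no `sorry`).  Sequel to ★ `HeckeFixedVectorsIntertwinersLevelwise` (`exists_intertwiningMap_extending_of_levelwise`, the `k`-LINEAR
form) exactly as ★ `HeckeFixedVectorsIntertwinersSemilinear` is the sequel of ★ `HeckeFixedVectorsIntertwiners`: the source `(ρ, W)` is a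
representation over `k`, the target `(σ, V)` over `k′`, the maps are `ι`-SEMILINEAR for a ring isomorphism `ι : k ≃+* k′` ([Liu2021] §4.2
«`ι_ℓ ∘ ω`»), and the `G`-SEMISIMPLICITY of `σ` is replaced by the LEVELWISE hypothesis: `V = ⋃_{K′ ∈ 𝓛} V^{K′}` for a family `𝓛` of subgroups
`K′ ≤ K` normalised by `K` with finite double cosets, and every Hecke-stable `k′`-subspace of `V^{K′}` has a Hecke-stable complement in `V^{K′}`.

Method: restriction of scalars along `ι` (`Module.compHom`): the `K′`-fixed vectors, the Hecke operators and — `ι` being bijective — the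
subspaces of `V` are the same over `k` and over `k′`, so the levelwise hypotheses transport and ★ `exists_intertwiningMap_extending_of_levelwise`
applies.

* §1 `exists_semilinear_intertwiner_extending_of_levelwise`.
* §2 `exists_stable_isCompl_of_isSemisimpleModule_adjoin` — the levelwise hypothesis in module currency: if `V^{K′}` (or any `M`) is a
  semisimple module over `k[S]` for a set `S` of operators, every `S`-stable subspace has an `S`-stable complement (converse of ★
  `isSemisimpleModule_adjoin_of_forall_exists_isCompl`).

Cell `hodgecm-mathlib` (d6 S2′, «S1c eliminator» (O-III)): with `k = ℂ`, `k′ = ℚ̄_ℓ`, `ι = ι_ℓ`, `V = ℚ̄_ℓ ⊗ H¹_ét(A_∞)`, `𝓛` = the small levels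
`K′ ⊴ K`, this is the form consumed by the levelwise twins of ★ `OmegaHomIsotypic` / ★ `OmegaHomIsotypicComponent`; count-neutral; HC_CM is proved
only modulo the 7 printed citations until rung 0 closes.

## References
* [Bump1997] D. Bump, *Automorphic Forms and Representations* (1997), Prop. 4.2.3 (p. 427).
* [BushnellHenniart2006] C. J. Bushnell, G. Henniart, *The Local Langlands Conjecture for GL(2)* (2006), §4.2 Lemma (p. 35), §4.3 Proposition (2)
  (pp. 38–39).
* [Liu2021] Y. Liu, *Fourier–Jacobi cycles and arithmetic relative trace formula*, Camb. J. Math. 9 (2021), §4.2 (FJcycle.tex l. 2162–2165).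
-/

set_option autoImplicit false

noncomputable section

open MulAction

namespace Literature.NumberTheory.Automorphic

section SemilinearLevelwise

variable {k k' G V W : Type*} [Field k] [CharZero k] [Field k'] [Group G] [AddCommGroup V] [Module k' V]
  [AddCommGroup W] [Module k W] (ι : k ≃+* k') (ρ : Representation k G W) (σ : Representation k' G V) (K : Subgroup G)

/-- **Semilinear levelwise extension theorem**: `ι : k ≃+* k′`, `ρ` irreducible over `k`, all double cosets of `K` finite, `𝓛` a family of
subgroups `K′ ≤ K` normalised by `K` with finite double cosets such that every vector of `V` is fixed by some `K′ ∈ 𝓛` and every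
Hecke-stable subspace of `V^{K′}` has a Hecke-stable complement in `V^{K′}` (`K′ ∈ 𝓛`), and an `ι`-semilinear `L : W → V` mapping `W^K`
into `V^K` and commuting there with the Hecke operators ⇒ there is an `ι`-semilinear `f : W →ₛₗ[ι] V` with `f ∘ ρ(g) = σ(g) ∘ f` for
all `g` and `f = L` on `W^K`. [cite: Bump1997, Prop. 4.2.3] [cite: BushnellHenniart2006, §4.2 Lemma (p. 35) and §4.3 Proposition (2) (pp. 38–39)]
[cite: Liu2021, §4.2 (FJcycle.tex l. 2162–2165)] -/
theorem exists_semilinear_intertwiner_extending_of_levelwise [ρ.IsIrreducible]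
    (hfin : ∀ g : G, (orbit K (g : G ⧸ K)).Finite)
    (𝓛 : Set (Subgroup G)) (h𝓛K : ∀ K' ∈ 𝓛, K' ≤ K) (h𝓛n : ∀ K' ∈ 𝓛, ∀ c ∈ K, ∀ x ∈ K', c⁻¹ * x * c ∈ K')
    (h𝓛fin : ∀ K' ∈ 𝓛, ∀ g : G, (orbit K' (g : G ⧸ K')).Finite)
    (hsm : ∀ v : V, ∃ K' ∈ 𝓛, v ∈ σ.fixedPoints K')
    (hss : ∀ K' ∈ 𝓛, ∀ N : Submodule k' V, N ≤ σ.fixedPoints K' → (∀ g : G, ∀ n ∈ N, heckeOperator σ K' g n ∈ N) →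
      ∃ C : Submodule k' V, C ≤ σ.fixedPoints K' ∧ (∀ g : G, ∀ c ∈ C, heckeOperator σ K' g c ∈ C) ∧
        N ⊓ C = ⊥ ∧ N ⊔ C = σ.fixedPoints K')
    (L : W →ₛₗ[(ι : k →+* k')] V)
    (hLK : ∀ w ∈ ρ.fixedPoints K, L w ∈ σ.fixedPoints K)
    (hL : ∀ g : G, ∀ w ∈ ρ.fixedPoints K, L (heckeOperator ρ K g w) = heckeOperator σ K g (L w)) :
    ∃ f : W →ₛₗ[(ι : k →+* k')] V, (∀ (g : G) (w : W), f (ρ g w) = σ g (f w)) ∧ ∀ w ∈ ρ.fixedPoints K, f w = L w := by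
  classical
  -- restrict the scalars of `V` along `ι`
  letI mk : Module k V := Module.compHom V (ι : k →+* k')
  have hsmul : ∀ (a : k) (v : V), (a • v : V) = (ι a : k') • v := fun _ _ => rfl
  -- `σ` as a `k`-representation
  let σk : Representation k G V :=
    { toFun := fun g =>
        { toFun := σ g
          map_add' := fun x y => map_add _ x y
          map_smul' := fun a v => by rw [hsmul, hsmul, map_smul]; rfl }
      map_one' := by ext v; simp
      map_mul' := fun g h => by ext v; simp }
  have hσk : ∀ (g : G) (v : V), σk g v = σ g v := fun _ _ => rfl
  -- same fixed vectors, same Hecke operators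
  have hfix : ∀ (K₁ : Subgroup G) (v : V), v ∈ σk.fixedPoints K₁ ↔ v ∈ σ.fixedPoints K₁ := fun K₁ v => by
    simp only [Representation.mem_fixedPoints, hσk]
  have hhecke : ∀ (K₁ : Subgroup G), (∀ g : G, (orbit K₁ (g : G ⧸ K₁)).Finite) → ∀ (g : G) (v : V),
      heckeOperator σk K₁ g v = heckeOperator σ K₁ g v := by
    intro K₁ hK₁ g v
    rw [heckeOperator, heckeOperator, finsum_mem_eq_finite_toFinset_sum _ (hK₁ g), finsum_mem_eq_finite_toFinset_sum _ (hK₁ g),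
      LinearMap.sum_apply, LinearMap.sum_apply]
    exact Finset.sum_congr rfl fun y _ => hσk _ _
  -- same subspaces (`ι` is bijective): a `k`-subspace as a `k′`-subspace and back
  have toK' : ∀ N : Submodule k V, ∃ N' : Submodule k' V, (N' : Set V) = N := by
    intro N
    refine ⟨{ carrier := (N : Set V)
              add_mem' := fun ha hb => N.add_mem ha hb
              zero_mem' := N.zero_mem
              smul_mem' := fun c v hv => ?_ }, rfl⟩
    change c • v ∈ N
    have : (ι.symm c) • v ∈ N := N.smul_mem _ hv
    rwa [hsmul, RingEquiv.apply_symm_apply] at this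
  have toK : ∀ N' : Submodule k' V, ∃ N : Submodule k V, (N : Set V) = N' := by
    intro N'
    refine ⟨{ carrier := (N' : Set V)
              add_mem' := fun ha hb => N'.add_mem ha hb
              zero_mem' := N'.zero_mem
              smul_mem' := fun a v hv => ?_ }, rfl⟩
    change a • v ∈ N'
    rw [hsmul]
    exact N'.smul_mem _ hv
  -- the levelwise hypotheses over `k`
  have hsm' : ∀ v : V, ∃ K' ∈ 𝓛, v ∈ σk.fixedPoints K' := fun v => by
    obtain ⟨K', hK', hv⟩ := hsm v
    exact ⟨K', hK', (hfix K' v).2 hv⟩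
  have hss' : ∀ K' ∈ 𝓛, ∀ N : Submodule k V, N ≤ σk.fixedPoints K' → (∀ g : G, ∀ n ∈ N, heckeOperator σk K' g n ∈ N) →
      ∃ C : Submodule k V, C ≤ σk.fixedPoints K' ∧ (∀ g : G, ∀ c ∈ C, heckeOperator σk K' g c ∈ C) ∧
        N ⊓ C = ⊥ ∧ N ⊔ C = σk.fixedPoints K' := by
    intro K' hK' N hNK hNst
    obtain ⟨N', hN'⟩ := toK' N
    have hmemN : ∀ v, v ∈ N' ↔ v ∈ N := fun v => by rw [← SetLike.mem_coe, hN', SetLike.mem_coe]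
    have hN'K : N' ≤ σ.fixedPoints K' := fun v hv => (hfix K' v).1 (hNK ((hmemN v).1 hv))
    have hN'st : ∀ g : G, ∀ n ∈ N', heckeOperator σ K' g n ∈ N' := fun g n hn => by
      rw [hmemN, ← hhecke K' (h𝓛fin K' hK')]
      exact hNst g n ((hmemN n).1 hn)
    obtain ⟨C', hC'K, hC'st, hNC', hNC'sup⟩ := hss K' hK' N' hN'K hN'st
    obtain ⟨C, hC⟩ := toK C'
    have hmemC : ∀ v, v ∈ C ↔ v ∈ C' := fun v => by rw [← SetLike.mem_coe, hC, SetLike.mem_coe]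
    refine ⟨C, fun v hv => (hfix K' v).2 (hC'K ((hmemC v).1 hv)), fun g c hc => ?_, ?_, ?_⟩
    · rw [hmemC, hhecke K' (h𝓛fin K' hK')]
      exact hC'st g c ((hmemC c).1 hc)
    · rw [eq_bot_iff]
      rintro v ⟨hvN, hvC⟩
      have : v ∈ N' ⊓ C' := ⟨(hmemN v).2 hvN, (hmemC v).1 hvC⟩
      rw [hNC'] at this
      rw [Submodule.mem_bot]
      exact (Submodule.mem_bot k').1 this
    · refine le_antisymm (sup_le hNK fun v hv => (hfix K' v).2 (hC'K ((hmemC v).1 hv))) fun v hv => ?_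
      have hv' : v ∈ N' ⊔ C' := by rw [hNC'sup]; exact (hfix K' v).1 hv
      obtain ⟨a, ha, b, hb, rfl⟩ := Submodule.mem_sup.1 hv'
      exact Submodule.add_mem_sup ((hmemN a).1 ha) ((hmemC b).2 hb)
  -- `L` as a `k`-linear map
  let Lk : W →ₗ[k] V :=
    { toFun := L
      map_add' := fun x y => map_add L x y
      map_smul' := fun a w => by rw [hsmul, LinearMap.map_smulₛₗ]; rfl }
  have hLk : ∀ w, Lk w = L w := fun _ => rfl
  obtain ⟨f, hf⟩ := exists_intertwiningMap_extending_of_levelwise ρ σk K hfin 𝓛 h𝓛K h𝓛n h𝓛fin hsm' hss' Lk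
    (fun w hw => (hfix K _).2 (hLK w hw)) (fun g w hw => by rw [hLk, hLk, hhecke K hfin]; exact hL g w hw)
  refine ⟨{ toFun := f, map_add' := fun x y => map_add f x y, map_smul' := fun a w => ?_ }, fun g w => ?_, fun w hw => ?_⟩
  · exact f.toLinearMap.map_smul a w
  · exact Representation.IntertwiningMap.isIntertwining ρ σk f g w
  · exact hf w hw

end SemilinearLevelwise

/-! ## §2 Stable complements over the generated algebra (converse of ★ `isSemisimpleModule_adjoin_of_forall_exists_isCompl`) -/

section Adjoin

variable {k M : Type*} [Field k] [AddCommGroup M] [Module k M]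

/-- **Semisimple over `k[S]` ⇒ `S`-stable complements.**  If `M` is a semisimple module over the subalgebra `k[S] = Algebra.adjoin k S ≤ End_k M`
generated by a set `S` of operators, then every `S`-stable subspace of `M` has an `S`-stable complement — the converse of ★
`HeckeFixedVectorsSemisimple.isSemisimpleModule_adjoin_of_forall_exists_isCompl`; this is the «levelwise hypothesis» of
`exists_semilinear_intertwiner_extending_of_levelwise` in module-theoretic currency. [cite: Bump1997, Prop. 4.2.3] -/
theorem exists_stable_isCompl_of_isSemisimpleModule_adjoin (S : Set (Module.End k M)) [IsSemisimpleModule (Algebra.adjoin k S) M]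
    (N : Submodule k M) (hN : ∀ s ∈ S, ∀ n ∈ N, s n ∈ N) :
    ∃ C : Submodule k M, (∀ s ∈ S, ∀ c ∈ C, s c ∈ C) ∧ IsCompl N C := by
  obtain ⟨N', hN'⟩ := exists_submodule_adjoin_of_forall_mem S N hN
  obtain ⟨C', hc⟩ := exists_isCompl N'
  refine ⟨C'.restrictScalars k, forall_mem_restrictScalars_of_submodule_adjoin S C', ?_⟩
  rw [← hN']
  exact (Submodule.isCompl_restrictScalars_iff (S := k)).2 hc

end Adjoin

end Literature.NumberTheory.Automorphic

end
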